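import Literature.NumberTheory.EllipticCurves.QuadraticTwistLDerivativeSeries
import Literature.NumberTheory.EllipticCurves.PAdicLFunctionNonvanishingProofs
import Literature.NumberTheory.EllipticCurves.LeadingTermPPartProofs
import Literature.NumberTheory.EllipticCurves.Curve5077aLambdaThirdDerivPos
import Literature.NumberTheory.EllipticCurves.ComplexMultiplication
import Mathlib.Analysis.SpecificLimits.Normed
import HarnessLib

/-!
# `L(E, 1) = 2 ∑ (aₙ/n) e^{-2πn/√N}` for root number `+1`, and a uniform positivity certificate
# (Cremona 1997, (2.11.1) and Prop. 2.13.1 with `r = 0`)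

Topic `NumberTheory/EllipticCurves`. Elliptic-curve form of the rapidly convergent series for the
central VALUE of the `L`-function of a modular elliptic curve `E/ℚ` of conductor `N` whose newform
`f_E` has Fricke eigenvalue `ε = -1`, i.e. analytic root number `w(E) = -ε = +1` (even order of
vanishing), [CremonaAlgorithms1997], §2.11, (2.11.1): "`L(f, 1) = (1 - ε)·(…)`", and Prop. 2.13.1
with `r = 0` ("`L^{(r)}(f,1) = 2 r! ∑ (a(n)/n) G_r(2πn/√N)`", `G₀(x) = e^{-x}`):

* `frickeInvolution_eq_neg_smul_of_rootNumber_eq_one` — `w(E) = +1` ⇒ `w_N f_E = -f_E` (mirror of the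
  tree's `frickeInvolution_eq_self_of_rootNumber_eq_neg_one`; Atkin–Lehner 1970, Thm. 3);
* `hasSum_entireLFunction_one_of_rootNumber_eq_one` — `w(E) = +1` ⇒
  `L(E, 1) = 2 ∑_{n ≥ 1} (aₙ(E)/n) e^{-2πn/√N_E}`, assembled from the tree's two-sided modular-symbol
  series `modularSymbol_eq_rayTail_sub` (cusp `0 = 0/1`, height `Y = 1/√N`, `ε = -1`) and
  `{∞, 0}_{f_E} = L(E, 1)` (`IsNewformOf.modularSymbol_zero_eq_entireLFunction_one`);
* `lValueSeries_ge` — the UNIFORM crude certificate: for integers `aₙ` with `a₁ = 1`, `|aₙ| ≤ n²`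
  and `0 < q < 1`, `2q - q/(1-q)² ≤ ∑ (aₙ/n) qⁿ` (all terms `n ≥ 2` bounded by `n qⁿ`,
  `∑ n qⁿ = q/(1-q)²`); positive as soon as `(1 - q)² > 1/2`, e.g. `q ≤ 29/100`;
* `entireLFunction_one_re_pos_of_rootNumber_eq_one` and
  `analyticRank_eq_zero_of_rootNumber_eq_one_of_exp_le` — every elliptic `E/ℚ` with `w(E) = +1` and
  `e^{-2π/√N_E} ≤ 29/100` (in particular `N_E ≤ 25`, `analyticRank_eq_zero_of_rootNumber_eq_one_of_conductorNorm_le`)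
  has `L(E, 1) > 0`, hence analytic rank `0`, **assuming only the Modularity Theorem**
  `exists_isNewformOf`; the only arithmetic input is `a₁ = 1` and `|aₙ(E)| ≤ n²`
  (`WeierstrassCurve.abs_LFunction_le_sq`).

Everything here is proved; no definition and no named fact is introduced (D-0026). Motivation: the
`r = 0` rung of the kernel-checked ladder of provable central orders (`r = 1`: `Curve37aAnalyticRankOne`;
`r = 3`: `Curve5077aAnalyticRankLeThree`); instance `11a` in `Curve11aAnalyticRankZero`.

## References

* [CremonaAlgorithms1997] J. E. Cremona, *Algorithms for Modular Elliptic Curves*, 2nd ed., CUP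
  1997, §2.11 (2.11.1), §2.13 Prop. 2.13.1 (held: `book:cremona1997-algorithms-modular-elliptic-curves-2nd-ed`,
  PDF pp. 33–36); worked instance Appendix to Ch. II, Example 1 (`N = 11`, PDF p. 43): "`L(f,1) =
  2∑_{n=1}^∞ (a(n)/n) tⁿ` where `t = exp(−2π/√11) = 0.15…`; … `L(f,1) = 0.2538418608559…`".
* [BuhlerGrossZagier1985] J. P. Buhler, B. H. Gross, D. B. Zagier, *On the conjecture of Birch and
  Swinnerton-Dyer for an elliptic curve of rank 3*, Math. Comp. 44 (1985), 473–481, §3.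
* [AtkinLehner1970] A. O. L. Atkin, J. Lehner, *Hecke operators on `Γ₀(m)`*, Math. Ann. 185 (1970),
  Thm. 3.
* [BCDTJAMS2001] C. Breuil, B. Conrad, F. Diamond, R. Taylor, J. Amer. Math. Soc. 14 (2001), Thm. A.
-/

noncomputable section

open scoped MatrixGroups ModularForm

open CongruenceSubgroup UpperHalfPlane Complex Filter Topology Set MeasureTheory

namespace Literature.NumberTheory.EllipticCurves

open WeierstrassCurve Literature.NumberTheory.EllipticCurves.ModularForms

/-! ### `w(E) = +1` ⇒ `w_N f_E = -f_E` -/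

/-- **`w(E) = +1` ⇒ `w_N f_E = -f_E`**: for the newform `f` of an elliptic `W/ℚ` at level `N_W`, the
analytic root number is `-ε(f)` (Hecke's functional equation transported to `Λ(W, s)`,
`hasFunctionalEquationSign_of_isNewformOf`, and `ε(f) = ±1`, Atkin–Lehner 1970, Thm. 3), so
`W.rootNumber = 1` rules out `ε(f) = +1` (which would give the sign `-1`) and forces `w_N f = -f`.
[cite: AtkinLehner1970, Thm. 3] [cite: CremonaAlgorithms1997, §2.8 (2.8.6) and §2.11] -/
theorem frickeInvolution_eq_neg_smul_of_rootNumber_eq_one (W : WeierstrassCurve ℚ) [W.IsElliptic]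
    [NeZero (W.conductorNorm ℤ)] {f : CuspForm (Gamma0 (W.conductorNorm ℤ)) 2}
    (hf : IsNewformOf W f) (hw : W.rootNumber = 1) :
    frickeInvolution (W.conductorNorm ℤ) 2 f = (-1 : ℂ) • f := by
  have hE : W.HasEntireLFunction := hf.hasEntireLFunction
  obtain ⟨Λ, hΛ, hfe⟩ := IsNewform0.exists_functional_equation_holds hf.1
  have key : ∀ w : ℤ, (w : ℂ) = -frickeEigenvalue f → W.HasFunctionalEquationSign w :=
    fun w hw' ↦ W.hasFunctionalEquationSign_of_isNewformOf hE hf hΛ hfe hw'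
  have hsmul := IsNewform0.frickeInvolution_eq_smul_holds hf.1
  rcases IsNewform0.frickeEigenvalue_eq_one_or_eq_neg_one_holds hf.1 with h1 | h1
  · exfalso
    have h' : W.HasFunctionalEquationSign (-1) := key (-1) (by rw [h1]; push_cast; ring)
    unfold WeierstrassCurve.rootNumber at hw
    rw [if_pos h'] at hw
    norm_num at hw
  · rwa [h1] at hsmul

/-- **The pointwise Fricke eigen-property with `ε = -1`** for the newform of a curve of root number
`+1`: `f(-1/(Nτ)) = -N τ² f(τ)` (`isFrickeEigen_of_frickeInvolution_eq_smul`).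
[cite: AtkinLehner1970, §2 and Thm. 3] -/
theorem isFrickeEigen_neg_one_of_rootNumber_eq_one (W : WeierstrassCurve ℚ) [W.IsElliptic]
    [NeZero (W.conductorNorm ℤ)] {f : CuspForm (Gamma0 (W.conductorNorm ℤ)) 2}
    (hf : IsNewformOf W f) (hw : W.rootNumber = 1) :
    IsFrickeEigen (W.conductorNorm ℤ) f (-1) :=
  isFrickeEigen_of_frickeInvolution_eq_smul _
    (frickeInvolution_eq_neg_smul_of_rootNumber_eq_one W hf hw)

/-! ### `L(E, 1) = 2 ∑ (aₙ/n) e^{-2πn/√N}` -/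

/-- **Cremona (2.11.1) / Prop. 2.13.1 (`r = 0`) for the newform**: if `f ∈ S₂(Γ₀(N))` satisfies
`f(-1/(Nτ)) = -N τ² f(τ)` (`ε = -1`), then `{∞, 0}_f = 2 T_f(0, 1/√N)`, `T_f(0, y) = ∑ aₙ e^{-2πny}/n`
(the two-sided series `modularSymbol_eq_rayTail_sub` at the cusp `0/1` with `a = 1`, `u = v = 0` and
the self-dual height `Y = 1/√N`, where `1/(N Y) = Y`). [cite: CremonaAlgorithms1997, §2.11 (2.11.1)] -/
theorem modularSymbol_zero_eq_two_mul_rayTail {N : ℕ} [NeZero N] (f : CuspForm (Gamma0 N) 2)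
    (hW : IsFrickeEigen N f (-1)) :
    modularSymbol f 0 = 2 * rayTail f 0 (Real.sqrt N)⁻¹ := by
  have hN : (0 : ℝ) < N := Nat.cast_pos.mpr (NeZero.pos N)
  have hs : 0 < Real.sqrt N := Real.sqrt_pos.mpr hN
  have hY : 0 < (Real.sqrt N)⁻¹ := inv_pos.mpr hs
  have h := modularSymbol_eq_rayTail_sub f hW (m := 1) one_pos (a := 1) (u := 0) (v := 0)
    (by ring) hY
  have hflip : 1 / ((N : ℝ) * ((1 : ℕ) : ℝ) ^ 2 * (Real.sqrt N)⁻¹) = (Real.sqrt N)⁻¹ := by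
    rw [Nat.cast_one, one_pow, mul_one, ← div_eq_mul_inv, Real.div_sqrt, one_div]
  rw [hflip] at h
  simp only [Int.cast_zero, Nat.cast_one, zero_div] at h
  rw [h]
  ring

/-- **`L(E, 1) = 2 ∑_{n ≥ 1} (aₙ(E)/n) e^{-2πn/√N_E}` for root number `+1`**, from the Modularity
Theorem (`hmod`) (Cremona 1997, (2.11.1) "`L(f,1) = (1 - ε)(…)`" with `ε = -1`; Prop. 2.13.1 with
`r = 0`, `G₀(x) = e^{-x}`; the method of Buhler–Gross–Zagier 1985): the newform `f_E` of level `N_E`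
has `ε = -1` (`isFrickeEigen_neg_one_of_rootNumber_eq_one`), `{∞,0}_{f_E} = 2 T_{f_E}(0, 1/√N)`
(`modularSymbol_zero_eq_two_mul_rayTail`), `T_f(0, y) = ∑ aₙ e^{-2πny}/n` (`hasSum_rayTail`), and
`{∞, 0}_{f_E} = L(E, 1)` (`IsNewformOf.modularSymbol_zero_eq_entireLFunction_one`), with
`aₙ(f_E) = aₙ(E)`. [cite: CremonaAlgorithms1997, Prop. 2.13.1 and (2.11.1)] [cite: BCDTJAMS2001, Thm. A] -/
theorem hasSum_entireLFunction_one_of_rootNumber_eq_one (hmod : exists_isNewformOf)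
    (W : WeierstrassCurve ℚ) [W.IsElliptic] (hw : W.rootNumber = 1) :
    HasSum (fun n : ℕ ↦ 2 * ((W.LFunction n : ℂ) / n) *
        (Real.exp (-(2 * Real.pi * n / Real.sqrt (W.conductorNorm ℤ))) : ℂ))
      (W.entireLFunction 1) := by
  haveI : NeZero (W.conductorNorm ℤ) := ⟨(W.conductorNorm_pos_holds).ne'⟩
  set N : ℕ := W.conductorNorm ℤ with hNdef
  obtain ⟨f, hf⟩ := hmod W
  have hN : (0 : ℝ) < N := Nat.cast_pos.mpr (NeZero.pos N)
  have hY : 0 < (Real.sqrt N)⁻¹ := inv_pos.mpr (Real.sqrt_pos.mpr hN)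
  have hFE := isFrickeEigen_neg_one_of_rootNumber_eq_one W hf hw
  have hM := modularSymbol_zero_eq_two_mul_rayTail f hFE
  have hT := hasSum_rayTail f 0 hY
  rw [two_pi_mul_integral_Ioi_eq_rayTail f 0 hY] at hT
  have h2 := hT.mul_left (2 : ℂ)
  rw [← hM, hf.modularSymbol_zero_eq_entireLFunction_one] at h2
  have hfun : (fun n : ℕ ↦ 2 * ((W.LFunction n : ℂ) / n) *
      (Real.exp (-(2 * Real.pi * n / Real.sqrt (W.conductorNorm ℤ))) : ℂ)) =
      fun i : ℕ ↦ 2 * (Complex.exp (2 * Real.pi * Complex.I * ((0 : ℚ) : ℂ) * i) * cuspCoeff f i *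
        ((Real.exp (-(2 * Real.pi * i) * (Real.sqrt N)⁻¹) / i : ℝ) : ℂ)) := by
    funext i
    rw [hf.2 i]
    simp only [Rat.cast_zero, mul_zero, zero_mul, Complex.exp_zero, one_mul]
    have : Real.exp (-(2 * Real.pi * i / Real.sqrt (W.conductorNorm ℤ))) =
        Real.exp (-(2 * Real.pi * i) * (Real.sqrt N)⁻¹) := by
      rw [hNdef]; congr 1; ring
    rw [this]
    push_cast
    ring
  rw [hfun]
  exact h2

/-! ### The uniform crude certificate `∑ (aₙ/n) qⁿ ≥ 2q - q/(1-q)²` -/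

/-- Termwise bound: for integers with `|aₙ| ≤ n²` and `0 ≤ q`, `|(aₙ/n) qⁿ| ≤ n qⁿ`. [folklore] -/
private theorem abs_term_le (a : ℕ → ℤ) (ha : ∀ n : ℕ, |(a n : ℝ)| ≤ (n : ℝ) ^ 2) {q : ℝ}
    (hq : 0 ≤ q) (n : ℕ) : |(a n : ℝ) / n * q ^ n| ≤ n * q ^ n := by
  rcases Nat.eq_zero_or_pos n with rfl | hn
  · simp
  have hn' : (0 : ℝ) < n := Nat.cast_pos.mpr hn
  rw [abs_mul, abs_div, abs_of_pos hn', abs_of_nonneg (pow_nonneg hq n)]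
  gcongr
  rw [div_le_iff₀ hn']
  calc |(a n : ℝ)| ≤ (n : ℝ) ^ 2 := ha n
    _ = n * n := by ring

/-- **The uniform certificate** ([CremonaAlgorithms1997], Prop. 2.13.1, `r = 0`, with every
coefficient beyond the first replaced by the crude bound `|aₙ| ≤ n²`): for integers `aₙ` with
`a₁ = 1`, `|aₙ| ≤ n²`, and `0 ≤ q < 1`, the series `∑_{n ≥ 1} (aₙ/n) qⁿ` converges and is
`≥ q - ∑_{n ≥ 2} n qⁿ = 2q - q/(1-q)²` (`∑_{n ≥ 1} n qⁿ = q/(1-q)²`,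
Mathlib `hasSum_coe_mul_geometric_of_norm_lt_one`). [cite: CremonaAlgorithms1997, Prop. 2.13.1] -/
theorem lValueSeries_ge (a : ℕ → ℤ) (ha1 : a 1 = 1) (ha : ∀ n : ℕ, |(a n : ℝ)| ≤ (n : ℝ) ^ 2)
    {q : ℝ} (hq0 : 0 ≤ q) (hq1 : q < 1) :
    Summable (fun n : ℕ ↦ (a n : ℝ) / n * q ^ n) ∧
      2 * q - q / (1 - q) ^ 2 ≤ ∑' n : ℕ, (a n : ℝ) / n * q ^ n := by
  have hnorm : ‖q‖ < 1 := by rw [Real.norm_of_nonneg hq0]; exact hq1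
  have hgeo : HasSum (fun n : ℕ ↦ (n : ℝ) * q ^ n) (q / (1 - q) ^ 2) :=
    hasSum_coe_mul_geometric_of_norm_lt_one hnorm
  have hsum : Summable (fun n : ℕ ↦ (a n : ℝ) / n * q ^ n) :=
    Summable.of_norm_bounded hgeo.summable (fun n ↦ by
      rw [Real.norm_eq_abs]; exact abs_term_le a ha hq0 n)
  refine ⟨hsum, ?_⟩
  -- lower comparison sequence: `2·[n = 1]·q - n qⁿ`
  set g : ℕ → ℝ := fun n ↦ 2 * (if n = 1 then q else 0) - n * q ^ n with hg
  have hind : HasSum (fun n : ℕ ↦ (if n = 1 then q else 0 : ℝ)) q := hasSum_ite_eq 1 q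
  have hgsum : HasSum g (2 * q - q / (1 - q) ^ 2) := (hind.mul_left 2).sub hgeo
  have hle : ∀ n : ℕ, g n ≤ (a n : ℝ) / n * q ^ n := by
    intro n
    by_cases hn : n = 1
    · subst hn
      have h1 : g 1 = q := by simp only [hg, if_true, Nat.cast_one, pow_one]; ring
      rw [h1, ha1]
      simp
    · simp only [hg, hn, if_false, mul_zero, zero_sub]
      have h := abs_term_le a ha hq0 n
      rw [abs_le] at h
      exact h.1
  exact hasSum_le hle hgsum hsum.hasSum

/-- **Positivity**: under the same hypotheses, `0 < ∑ (aₙ/n) qⁿ` whenever `0 < q ≤ 29/100`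
(`(1 - q)² ≥ 0.5041 > 1/2`). [cite: CremonaAlgorithms1997, Prop. 2.13.1] -/
theorem lValueSeries_pos (a : ℕ → ℤ) (ha1 : a 1 = 1) (ha : ∀ n : ℕ, |(a n : ℝ)| ≤ (n : ℝ) ^ 2)
    {q : ℝ} (hq0 : 0 < q) (hq1 : q ≤ 29 / 100) :
    0 < ∑' n : ℕ, (a n : ℝ) / n * q ^ n := by
  obtain ⟨-, hge⟩ := lValueSeries_ge a ha1 ha hq0.le (by linarith)
  have h1 : 0 < 1 - q := by linarith
  have h3 : (71 / 100 : ℝ) ≤ 1 - q := by linarith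
  have h4 : (71 / 100 : ℝ) ^ 2 ≤ (1 - q) ^ 2 := pow_le_pow_left₀ (by norm_num) h3 2
  have hkey : q / (1 - q) ^ 2 < 2 * q := by
    rw [div_lt_iff₀ (by positivity)]
    have h5 : q * 1 < q * (2 * (1 - q) ^ 2) := mul_lt_mul_of_pos_left (by nlinarith [h4]) hq0
    linarith
  linarith

/-! ### `L(E, 1) > 0` and analytic rank `0` for root number `+1` and small conductor -/

/-- **`L(E, 1) > 0`** for an elliptic `E/ℚ` with `w(E) = +1` and `e^{-2π/√N_E} ≤ 29/100`, from the
Modularity Theorem (`hmod`): `L(E,1) = 2 ∑ (aₙ/n) qⁿ` with `q = e^{-2π/√N_E}`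
(`hasSum_entireLFunction_one_of_rootNumber_eq_one`), `a₁ = 1`, `|aₙ| ≤ n²`
(`WeierstrassCurve.abs_LFunction_le_sq`), and `lValueSeries_pos`.
[cite: CremonaAlgorithms1997, Prop. 2.13.1] [cite: BCDTJAMS2001, Thm. A] -/
theorem entireLFunction_one_re_pos_of_rootNumber_eq_one (hmod : exists_isNewformOf)
    (W : WeierstrassCurve ℚ) [W.IsElliptic] (hw : W.rootNumber = 1)
    (hq : Real.exp (-(2 * Real.pi / Real.sqrt (W.conductorNorm ℤ))) ≤ 29 / 100) :
    0 < (W.entireLFunction 1).re := by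
  set q : ℝ := Real.exp (-(2 * Real.pi / Real.sqrt (W.conductorNorm ℤ))) with hqdef
  have hsum := hasSum_entireLFunction_one_of_rootNumber_eq_one hmod W hw
  have hsum' : HasSum (fun n : ℕ ↦ ((2 * ((W.LFunction n : ℝ) / n * q ^ n) : ℝ) : ℂ))
      (W.entireLFunction 1) := by
    convert hsum using 2 with n
    rw [hqdef, ← Real.exp_nat_mul]
    push_cast
    ring_nf
  have hre := Complex.hasSum_re hsum'
  simp only [Complex.ofReal_re] at hre
  rw [← hre.tsum_eq, tsum_mul_left]
  have ha1 : W.LFunction 1 = 1 := W.isMultiplicative_LFunction.map_one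
  have hpos := lValueSeries_pos (fun n ↦ W.LFunction n) ha1 (fun n ↦ W.abs_LFunction_le_sq n)
    (Real.exp_pos _) hq
  positivity

/-- **`L(E, 1) ≠ 0`** under the same hypotheses. [cite: CremonaAlgorithms1997, Prop. 2.13.1] -/
theorem entireLFunction_one_ne_zero_of_rootNumber_eq_one_of_exp_le (hmod : exists_isNewformOf)
    (W : WeierstrassCurve ℚ) [W.IsElliptic] (hw : W.rootNumber = 1)
    (hq : Real.exp (-(2 * Real.pi / Real.sqrt (W.conductorNorm ℤ))) ≤ 29 / 100) :
    W.entireLFunction 1 ≠ 0 := fun h0 ↦ by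
  have h := entireLFunction_one_re_pos_of_rootNumber_eq_one hmod W hw hq
  rw [h0, Complex.zero_re] at h
  exact lt_irrefl 0 h

/-- **Analytic rank `0`** for an elliptic `E/ℚ` with `w(E) = +1` and `e^{-2π/√N_E} ≤ 29/100`, from
the Modularity Theorem alone: `ord_{s=1} L(E, s) = 0` since `L(E, 1) ≠ 0`
(`analyticRank_eq_zero_of_entireLFunction_one_ne_zero`).
[cite: CremonaAlgorithms1997, Prop. 2.13.1] [cite: BCDTJAMS2001, Thm. A] -/
theorem analyticRank_eq_zero_of_rootNumber_eq_one_of_exp_le (hmod : exists_isNewformOf)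
    (W : WeierstrassCurve ℚ) [W.IsElliptic] (hw : W.rootNumber = 1)
    (hq : Real.exp (-(2 * Real.pi / Real.sqrt (W.conductorNorm ℤ))) ≤ 29 / 100) :
    W.analyticRank = 0 :=
  analyticRank_eq_zero_of_entireLFunction_one_ne_zero W
    (entireLFunction_one_ne_zero_of_rootNumber_eq_one_of_exp_le hmod W hw hq)

/-- `e^{-2π/√N} ≤ 29/100` for `1 ≤ N ≤ 25`: `2π/√N ≥ 2π/5 > 1.2566` and
`e^{1.2566} ≥ e · (1 + 0.2566 + 0.2566²/2) > 100/29`. [folklore] -/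
private theorem exp_neg_two_pi_div_sqrt_le {N : ℕ} (hN0 : 0 < N) (hN : N ≤ 25) :
    Real.exp (-(2 * Real.pi / Real.sqrt N)) ≤ 29 / 100 := by
  have hpi := Real.pi_gt_d6
  have he := Real.exp_one_gt_d9
  -- `√N ≤ 5`
  have hs : Real.sqrt N ≤ 5 := by
    rw [show (5 : ℝ) = Real.sqrt 25 by rw [show (25 : ℝ) = 5 ^ 2 by norm_num,
      Real.sqrt_sq (by norm_num)]]
    exact Real.sqrt_le_sqrt (by exact_mod_cast hN)
  have hs0 : 0 < Real.sqrt N := Real.sqrt_pos.mpr (Nat.cast_pos.mpr hN0)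
  set x := 2 * Real.pi / Real.sqrt N with hxdef
  have hx : 1 + 0.2566 ≤ x := by
    rw [hxdef, le_div_iff₀ hs0]
    nlinarith
  -- `e^{x} = e^1 · e^{x-1} ≥ e · (1 + (x-1) + (x-1)²/2) > 100/29`
  have hx1 : 0 ≤ x - 1 := by linarith
  have hq := Real.quadratic_le_exp_of_nonneg hx1
  have hexp : Real.exp x = Real.exp 1 * Real.exp (x - 1) := by
    rw [← Real.exp_add]; congr 1; ring
  rw [Real.exp_neg, inv_le_comm₀ (Real.exp_pos x) (by norm_num), hexp]
  have hlow : (1.2895 : ℝ) ≤ Real.exp (x - 1) := by nlinarith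
  nlinarith [Real.exp_pos (x - 1)]

/-- **Every modular elliptic curve over `ℚ` with root number `+1` and conductor `≤ 25` has analytic
rank `0`** (`L(E,1) > 0` by the uniform certificate; the curves concerned are those of conductor
`11, 14, 15, 17, 19, 20, 21, 24`, all of rank `0` in Cremona's Table 1).
[cite: CremonaAlgorithms1997, Prop. 2.13.1 and Table 1] [cite: BCDTJAMS2001, Thm. A] -/
theorem analyticRank_eq_zero_of_rootNumber_eq_one_of_conductorNorm_le (hmod : exists_isNewformOf)
    (W : WeierstrassCurve ℚ) [W.IsElliptic] (hw : W.rootNumber = 1) (hN : W.conductorNorm ℤ ≤ 25) :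
    W.analyticRank = 0 :=
  analyticRank_eq_zero_of_rootNumber_eq_one_of_exp_le hmod W hw
    (exp_neg_two_pi_div_sqrt_le W.conductorNorm_pos_holds hN)

end Literature.NumberTheory.EllipticCurves

end
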